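import Literature.Algebra.InverseSystem.AddInverseLimitExact
import HarnessLib

/-!
# Exactness of sequential inverse limits, II: towers of compact Hausdorff groups (profinite kernels)

Companion of `AddInverseLimitExact.lean` (Mittag-Leffler for towers of FINITE groups, the lifting lemma
and Atiyah–Macdonald Prop. 10.2 on `Literature.Algebra.InverseSystem.addInverseLimit`). Here the
finiteness of the kernel tower is relaxed to COMPACTNESS: for Hausdorff topological abelian groups with
continuous transition maps,

* `exists_sub_transition_eq_of_compactSpace` — Mittag-Leffler, surjectivity form (`lim¹ K = 0`) for a
  tower of compact Hausdorff groups (same compactness proof; Weibel Prop. 3.5.7: the images of compact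
  groups stabilise);
* `addInverseLimit.exists_map_eq_of_forall_mem_range_of_isCompact_ker` — the lifting lemma for tower
  maps with compact kernels, and its consequences
  `addInverseLimit.map_surjective_of_surjective_of_isCompact_ker`,
  `addInverseLimit.ker_map_le_range_map_of_isCompact_ker` (Atiyah–Macdonald Prop. 10.2 for compact
  kernel systems).

Case of use: towers of PROFINITE groups, e.g. the `n`-tower `lim←_m ker f_{n,m}` left after a first
passage to the limit in `m` of a doubly indexed system of finite groups (the `Λ`-adic carriers of the
tree are indexed by `(n, m)` = (layer, `p`-power level)). All statements are proved; there are no named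
facts in this file; nothing is asserted about any arithmetic object.

References: [Weibel1994] §3.5, Def. 3.5.6, Prop. 3.5.7; [AtiyahMacdonald1969] Ch. 10, Prop. 10.2.
-/

namespace Literature.Algebra.InverseSystem

universe u v w

open Function

/-! ### Mittag-Leffler for towers of compact Hausdorff groups (profinite kernel towers) -/

section Compact

variable {K : ℕ → Type u} [∀ m, AddCommGroup (K m)] [∀ m, TopologicalSpace (K m)]
  [∀ m, IsTopologicalAddGroup (K m)] [∀ m, CompactSpace (K m)] [∀ m, T2Space (K m)]

/-- **Mittag-Leffler for a tower of compact Hausdorff topological groups with continuous transition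
maps, surjectivity form** (`lim¹ K = 0`): for every family `d` there is `k` with
`k_m - t_m k_{m+1} = d_m` for all `m`. Same compactness proof as the finite case
(`exists_sub_transition_eq_of_finite`, which it generalises: finite discrete groups are compact
Hausdorff): the finite-stage solution sets are non-empty (`exists_sub_transition_eq_of_lt`), closed
(continuity, Hausdorff) and decreasing in the compact product `Π_m K m`. The case of use: towers of
profinite groups, e.g. the kernel towers `lim←_m ker f_{n,m}` (in `n`) left after a first passage to the
limit in `m` of a doubly indexed system of finite groups.
[cite: Weibel1994, §3.5 Def. 3.5.6, Prop. 3.5.7 (images of compact groups stabilise: Mittag-Leffler)]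
[cite: AtiyahMacdonald1969, Ch. 10, proof of Prop. 10.2] -/
theorem exists_sub_transition_eq_of_compactSpace (t : ∀ m, K (m + 1) →+ K m)
    (ht : ∀ m, Continuous (t m)) (d : ∀ m, K m) :
    ∃ k : ∀ m, K m, ∀ m, k m - t m (k (m + 1)) = d m := by
  let C : ℕ → Set (∀ m, K m) := fun N ↦ {k | ∀ m < N, k m - t m (k (m + 1)) = d m}
  have hC : ∀ N, IsClosed (C N) := by
    intro N
    have : C N = ⋂ (m : ℕ) (_ : m < N), {k | k m - t m (k (m + 1)) = d m} := by
      ext k; simp [C]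
    rw [this]
    refine isClosed_iInter fun m ↦ isClosed_iInter fun _ ↦ ?_
    refine isClosed_eq ?_ continuous_const
    exact (continuous_apply m).sub ((ht m).comp (continuous_apply (m + 1)))
  have hC' : ∀ N, C (N + 1) ⊆ C N := fun N k hk m hm ↦ hk m (by omega)
  have hCne : ∀ N, (C N).Nonempty := fun N ↦ exists_sub_transition_eq_of_lt N t d
  obtain ⟨k, hk⟩ := IsCompact.nonempty_iInter_of_sequence_nonempty_isCompact_isClosed C hC' hCne
    (hC 0).isCompact hC
  exact ⟨k, fun m ↦ (Set.mem_iInter.1 hk (m + 1)) m (Nat.lt_succ_self m)⟩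

end Compact

namespace addInverseLimit

section CompactKernels

variable {A : ℕ → Type u} {B : ℕ → Type v} [∀ m, AddCommGroup (A m)] [∀ m, AddCommGroup (B m)]
  [∀ m, TopologicalSpace (A m)] [∀ m, IsTopologicalAddGroup (A m)] [∀ m, T2Space (A m)]
  {tA : ∀ m, A (m + 1) →+ A m} {tB : ∀ m, B (m + 1) →+ B m}
  {f : ∀ m, A m →+ B m} {hf : ∀ m x, tB m (f (m + 1) x) = f m (tA m x)}

/-- **The lifting lemma, compact kernels**: if the `A m` are Hausdorff topological groups with
continuous transition maps and every kernel `ker f_m` is COMPACT, then every compatible family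
`x ∈ lim B` with `x_m ∈ range f_m` for all `m` is `lim f (a)` for some compatible `a ∈ lim A`
(Mittag-Leffler for the compact kernel tower, `exists_sub_transition_eq_of_compactSpace`, then
`exists_map_eq_of_forall_mem_range_of_ker_limOne`). Generalises the finite-kernel lemma; the case of
use is a tower of profinite groups (e.g. after a first `lim←` in a doubly indexed system).
[cite: Weibel1994, §3.5 Prop. 3.5.7] [cite: AtiyahMacdonald1969, Ch. 10, Prop. 10.2] -/
theorem exists_map_eq_of_forall_mem_range_of_isCompact_ker (htA : ∀ m, Continuous (tA m))
    (hker : ∀ m, IsCompact ((f m).ker : Set (A m)))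
    (x : addInverseLimit tB) (hx : ∀ m, (x : ∀ m, B m) m ∈ (f m).range) :
    ∃ a : addInverseLimit tA, map tA tB f hf a = x := by
  refine exists_map_eq_of_forall_mem_range_of_ker_limOne (fun d hd ↦ ?_) x hx
  haveI : ∀ m, CompactSpace (f m).ker := fun m ↦ isCompact_iff_compactSpace.1 (hker m)
  -- the kernel tower `ker f_{m+1} →+ ker f_m` (restriction of `tA m`), continuous for the subspace
  -- topologies
  let tK : ∀ m, (f (m + 1)).ker →+ (f m).ker := fun m ↦
    ((tA m).comp (f (m + 1)).ker.subtype).codRestrict (f m).ker fun y ↦ transition_mem_ker hf m y.2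
  have htK : ∀ m, Continuous (tK m) := fun m ↦
    ((htA m).comp continuous_subtype_val).subtype_mk _
  obtain ⟨k, hk⟩ := exists_sub_transition_eq_of_compactSpace (K := fun m ↦ (f m).ker) tK htK
    (fun m ↦ ⟨d m, hd m⟩)
  refine ⟨fun m ↦ (k m : A m), fun m ↦ (k m).2, fun m ↦ ?_⟩
  have := congrArg (fun y : (f m).ker ↦ (y : A m)) (hk m)
  simpa [AddSubgroup.coe_sub, tK] using this

/-- **Levelwise onto with compact kernels ⟹ onto on limits** (Hausdorff topological groups,
continuous transitions). [cite: AtiyahMacdonald1969, Ch. 10, Prop. 10.2] [cite: Weibel1994, §3.5 Prop. 3.5.7] -/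
theorem map_surjective_of_surjective_of_isCompact_ker {C : ℕ → Type w} [∀ m, AddCommGroup (C m)]
    {tC : ∀ m, C (m + 1) →+ C m} {g : ∀ m, A m →+ C m}
    {hg : ∀ m x, tC m (g (m + 1) x) = g m (tA m x)} (htA : ∀ m, Continuous (tA m))
    (hsurj : ∀ m, Surjective (g m)) (hker : ∀ m, IsCompact ((g m).ker : Set (A m))) :
    Surjective (map tA tC g hg) := fun x ↦
  exists_map_eq_of_forall_mem_range_of_isCompact_ker htA hker x fun m ↦ hsurj m _

/-- **Middle exactness on limits from levelwise exactness, compact kernels**: if `ker g_m ≤ range f_m`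
for every `m`, the `A m` are Hausdorff topological groups with continuous transitions and every
`ker f_m` is compact, then `ker (lim g) ≤ range (lim f)`.
[cite: Weibel1994, §3.5 Prop. 3.5.7] [cite: AtiyahMacdonald1969, Ch. 10, Prop. 10.2] -/
theorem ker_map_le_range_map_of_isCompact_ker {C : ℕ → Type w} [∀ m, AddCommGroup (C m)]
    {tC : ∀ m, C (m + 1) →+ C m} {g : ∀ m, B m →+ C m}
    {hg : ∀ m x, tC m (g (m + 1) x) = g m (tB m x)} (htA : ∀ m, Continuous (tA m))
    (hexact : ∀ m, (g m).ker ≤ (f m).range) (hker : ∀ m, IsCompact ((f m).ker : Set (A m))) :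
    (map tB tC g hg).ker ≤ (map tA tB f hf).range := by
  intro x hx
  obtain ⟨a, ha⟩ := exists_map_eq_of_forall_mem_range_of_isCompact_ker (hf := hf) htA hker x
    (forall_mem_range_of_mem_ker hexact hx)
  exact ⟨a, ha⟩

end CompactKernels

end addInverseLimit

end Literature.Algebra.InverseSystem
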